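import Summits.QuantumFields.YangMills.Theses.LangevinControlUV
import Literature.MathematicalPhysics.QuantumFieldTheory.WilsonFlow

/-!
# Sketch — crux-ideate round 1, ideator 1, crux `FemtoCurvatureTwoPointC` (stmt-QuantumFields-16204)

First-lemma signatures for the two idea cards of this seat (no skeleton, no stubs registered):

* § Defs      — the C body unbundled at a fixed bare representation `ρ` (`PackageC ρ`), as in the
                 predecessor's `Disproof.lean` § Defs with `Continuous a ∧` inserted.
* § CardA     — card `intrinsic-coupling-encoding`: an ADMISSIBLE FINITE-VOLUME COUPLING `u L β`
                 (abstract; instances: tree-normalised curvature scheme, gradient-flow scheme via the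
                 tree's `wilsonFlow`), the three intrinsic statements `AFStep` (two-sided discrete
                 β-function = asymptotic freedom as an inequality), `AxisMatching`, `PairMatching`,
                 and the reduction `IntrinsicEncoding ρ` (their conjunction ⇒ `PackageC ρ`), plus the
                 arithmetic heart `two_sided_of_steps` (proved).
* § CardB     — card `conditional-covariance-floor`: the law of total covariance / invariant
                 conditioning floor over Mathlib's `condExp` and `covariance` (signatures), transverse
                 block plaquettes, `SmearingDomination` (Bochner/RP, provable now) and
                 `BlockMatchingLower`, with the composition `axisMatchingLower_of_block` (proved).
-/

set_option autoImplicit false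

noncomputable section

open Filter Topology MeasureTheory ProbabilityTheory
open Literature.MathematicalPhysics.QuantumFieldTheory Literature.MathematicalPhysics.QuantumLattice

namespace Summit.QuantumFields.YangMills.Cruxes.FemtoCurvatureTwoPointC.Ideator1

/-! ## § Defs -/

section Defs

variable {G : Type} [Group G] [TopologicalSpace G] [IsTopologicalGroup G] [CompactSpace G]
  [MeasurableSpace G] [BorelSpace G] {N : ℕ}

/-- The plaquette field `P_x^{ij}(U) = N - Re tr ρ(U_{p(x;i,j)})`. -/
def plaq (ρ : G →* Matrix (Fin N) (Fin N) ℂ) {L : ℕ} (x : Site 4 L) (i j : Fin 4)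
    (U : GaugeConfig 4 L G) : ℝ :=
  (N : ℝ) - (ρ (plaquetteHolonomy U x i j)).trace.re

/-- Covariance under Wilson's measure. -/
def cov (ρ : G →* Matrix (Fin N) (Fin N) ℂ) {L : ℕ} [NeZero L] (β : ℝ)
    (F F' : GaugeConfig 4 L G → ℝ) : ℝ :=
  wilsonExpectation (d := 4) (L := L) ρ β (fun U => F U * F' U) -
    wilsonExpectation (d := 4) (L := L) ρ β F * wilsonExpectation (d := 4) (L := L) ρ β F'

/-- Torus Euclidean distance. -/
def tdist {L : ℕ} (x y : Site 4 L) : ℝ :=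
  Real.sqrt (∑ k : Fin 4, (((x k - y k).valMinAbs : ℤ) : ℝ) ^ 2)

/-- The rescaled axis amplitude `n⁸ · Cov(P_0^{01}, P_{n e₂}^{01})` on the torus of side `L`. -/
def axisAmp (ρ : G →* Matrix (Fin N) (Fin N) ℂ) (L : ℕ) [NeZero L] (β : ℝ) (n : ℕ) : ℝ :=
  (n : ℝ) ^ 8 * cov ρ β (plaq ρ (0 : Site 4 L) 0 1) (plaq ρ (Pi.single (2 : Fin 4) ((n : ℕ) : ZMod L)) 0 1)

/-- The two clauses of the crux on ONE torus at ONE coupling. -/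
def ClausesC (ρ : G →* Matrix (Fin N) (Fin N) ℂ) (a Γ : ℝ → ℝ) (c C : ℝ) (L : ℕ) [NeZero L]
    (β : ℝ) : Prop :=
  (∀ n : ℕ, 1 ≤ n → 8 * n ≤ L →
      c * Γ ((n : ℝ) * a β) ≤ axisAmp ρ L β n ∧ axisAmp ρ L β n ≤ C * Γ ((n : ℝ) * a β)) ∧
    ∀ (x y : Site 4 L) (i j i' j' : Fin 4), x ≠ y → i ≠ j → i' ≠ j' →
      |cov ρ β (plaq ρ x i j) (plaq ρ y i' j')| * tdist x y ^ 8 ≤ C * Γ (tdist x y * a β)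

/-- The C package at a bare representation with explicit data `(a, Γ, β₀, ℓ₀, c, C)`. -/
def PackageCWith (ρ : G →* Matrix (Fin N) (Fin N) ℂ) (a Γ : ℝ → ℝ) (β₀ ℓ₀ c C : ℝ) : Prop :=
  0 < ℓ₀ ∧ 0 < c ∧ (∀ β, 0 < a β) ∧ Tendsto a atTop (𝓝 0) ∧
    (∀ s : ℝ, 0 < s → s ≤ ℓ₀ → 0 < Γ s ∧ Γ s ≤ 1) ∧
      ∀ (L : ℕ) [NeZero L] (β : ℝ), β₀ ≤ β → (L : ℝ) * a β ≤ ℓ₀ → ClausesC ρ a Γ c C L β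

/-- **The crux C at a fixed compact group and bare representation**: a CONTINUOUS unit map and data. -/
def PackageC (ρ : G →* Matrix (Fin N) (Fin N) ℂ) : Prop :=
  ∃ a : ℝ → ℝ, Continuous a ∧ ∃ (Γ : ℝ → ℝ) (β₀ ℓ₀ c C : ℝ), PackageCWith ρ a Γ β₀ ℓ₀ c C

end Defs

/-! ## § CardA — intrinsic-coupling encoding

`u : ℕ → ℝ → ℝ`, `u L β` = a renormalised finite-volume coupling of the torus of side `L` at bare coupling
`β` (think `ḡ²(L a)`): e.g. the tree-normalised curvature coupling
`(axisAmp ρ L β (L/8) / treeKernelFactor L)^{1/2}` (definable now for every `G, ρ`), or the gradient-flow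
coupling `N_c⁻¹ · t² ⟨E(wilsonFlow t ·)⟩_{L,β}` at `√(8t) = c L` (definable now for `SU(n)` via the tree's
`wilsonFlow`).  Nothing below fixes the instance. -/

section CardA

variable {G : Type} [Group G] [TopologicalSpace G] [IsTopologicalGroup G] [CompactSpace G]
  [MeasurableSpace G] [BorelSpace G] {N : ℕ}

/-- Hereditary perturbative window: every sub-box `8 ≤ L' ≤ L` has coupling `≤ u₀` at `β`. -/
def InWindow (u : ℕ → ℝ → ℝ) (u₀ : ℝ) (L : ℕ) (β : ℝ) : Prop :=
  ∀ L' : ℕ, 8 ≤ L' → L' ≤ L → u L' β ≤ u₀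

/-- Regularity of an admissible coupling: positive, continuous in `β`, and FREEZING on every fixed
torus (`u L β → 0` as `β → ∞`; for the two instances this is the landed
`tendsto_cov_plaq` / concentration of Wilson's measure on flat configurations). -/
structure AdmissibleCoupling (u : ℕ → ℝ → ℝ) (β₀ : ℝ) : Prop where
  pos : ∀ (L : ℕ) (β : ℝ), 8 ≤ L → β₀ ≤ β → 0 < u L β
  cont : ∀ L : ℕ, 8 ≤ L → ContinuousOn (u L) (Set.Ici β₀)
  freeze : ∀ L : ℕ, 8 ≤ L → Tendsto (u L) atTop (𝓝 0)

/-- **AF step inequality** (asymptotic freedom as a two-sided inequality on the discrete β-function):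
inside the window the inverse couplings of a box and of any box at most twice as large differ by at
most `κ₂` (local comparability — no exact monotonicity in `L` is asked, lattice artefacts may wiggle),
and under a full doubling the inverse coupling DROPS by at least `κ₁ > 0`.  Fails for `U(1)` (`κ₁ = 0`). -/
def AFStep (u : ℕ → ℝ → ℝ) (u₀ β₀ κ₁ κ₂ : ℝ) : Prop :=
  0 < κ₁ ∧ κ₁ ≤ κ₂ ∧
    ∀ (L L' : ℕ) (β : ℝ), β₀ ≤ β → 8 ≤ L → L ≤ L' → L' ≤ 2 * L → InWindow u u₀ L β →
      |(u L β)⁻¹ - (u L' β)⁻¹| ≤ κ₂ ∧ (L' = 2 * L → κ₁ ≤ (u L β)⁻¹ - (u L' β)⁻¹)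

/-- **Axis matching** (per datum, O(1) precision): in a window box the axis amplitude at separation `n`
is two-sidedly the SQUARE of the coupling of the box of side `8n`. -/
def AxisMatching (ρ : G →* Matrix (Fin N) (Fin N) ℂ) (u : ℕ → ℝ → ℝ) (u₀ β₀ c C : ℝ) : Prop :=
  ∀ (L : ℕ) [NeZero L] (β : ℝ) (n : ℕ), β₀ ≤ β → 1 ≤ n → 8 * n ≤ L → InWindow u u₀ L β →
    c * u (8 * n) β ^ 2 ≤ axisAmp ρ L β n ∧ axisAmp ρ L β n ≤ C * u (8 * n) β ^ 2

/-- **Pair matching** (upper only): `|Cov(P_x^{ij}, P_y^{i'j'})| · dist⁸ ≤ C · u(8⌈dist⌉ ∧ L ∨ 8)²`. -/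
def PairMatching (ρ : G →* Matrix (Fin N) (Fin N) ℂ) (u : ℕ → ℝ → ℝ) (u₀ β₀ C : ℝ) : Prop :=
  ∀ (L : ℕ) [NeZero L] (β : ℝ) (x y : Site 4 L) (i j i' j' : Fin 4), β₀ ≤ β → InWindow u u₀ L β →
    x ≠ y → i ≠ j → i' ≠ j' →
      |cov ρ β (plaq ρ x i j) (plaq ρ y i' j')| * tdist x y ^ 8 ≤
        C * u (max 8 (min L (8 * ⌈tdist x y⌉₊))) β ^ 2

/-- **First lemma of card A (the reduction to be kernel-checked in crux-plan):** for every admissible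
coupling, AF step inequality ∧ axis matching ∧ pair matching ⇒ the C package at `ρ`, with
`a(β) := ℓ₀ · 2^{-Ĵ(β)}` (`Ĵ` a continuous count of the window octaves) and
`Γ(s) := (u₀^{-1/2}… )` read off the step bounds — no chain, no cross-`β` comparison. -/
def IntrinsicEncoding (ρ : G →* Matrix (Fin N) (Fin N) ℂ) : Prop :=
  ∀ (u : ℕ → ℝ → ℝ) (u₀ β₀ κ₁ κ₂ c C : ℝ), 0 < u₀ → 0 < c →
    AdmissibleCoupling u β₀ → AFStep u u₀ β₀ κ₁ κ₂ →
      AxisMatching ρ u u₀ β₀ c C → PairMatching ρ u u₀ β₀ C → PackageC ρ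

/-- **Arithmetic heart of the encoding (backward determination).** If consecutive increments of a real
sequence lie in `[κ₁, κ₂]`, its values are pinned two-sidedly by the index alone. Applied to
`f k = (u (8·2^(J-k)) β)⁻¹` from the window-exit index `J(β)` downwards, this is why the amplitude at
separation `n` depends on `(β, n)` only through `J(β) − log₂ n = log₂(ℓ₀/(8 n a(β))) + O(1)`. -/
theorem two_sided_of_steps {f : ℕ → ℝ} {κ₁ κ₂ : ℝ} {K : ℕ}
    (h : ∀ k, k < K → κ₁ ≤ f (k + 1) - f k ∧ f (k + 1) - f k ≤ κ₂) :
    ∀ k, k ≤ K → f 0 + κ₁ * k ≤ f k ∧ f k ≤ f 0 + κ₂ * k := by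
  intro k
  induction k with
  | zero => intro _; simp
  | succ m ih =>
    intro hm
    have hm' : m < K := Nat.lt_of_succ_le hm
    obtain ⟨h1, h2⟩ := ih hm'.le
    obtain ⟨h3, h4⟩ := h m hm'
    push_cast
    constructor <;> nlinarith

/-- **Window exit is forced by the AF lower step bound**: an inverse coupling that drops by at least
`κ₁ > 0` per doubling while the box stays in the window cannot stay positive for more than `f 0 / κ₁`
doublings — so `sup_L u(L, β) > u₀` and the femto scale `J(β)` is finite (no infrared input needed). -/
theorem exit_of_steps {f : ℕ → ℝ} {κ₁ : ℝ} {K : ℕ} (hκ : 0 < κ₁)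
    (h : ∀ k, k < K → κ₁ ≤ f k - f (k + 1)) (hpos : 0 < f K) : (K : ℝ) < f 0 / κ₁ := by
  have key : ∀ k, k ≤ K → f k ≤ f 0 - κ₁ * k := by
    intro k
    induction k with
    | zero => intro _; simp
    | succ m ih =>
      intro hm
      have hm' : m < K := Nat.lt_of_succ_le hm
      have := ih hm'.le
      have := h m hm'
      push_cast
      nlinarith
  have hK := key K le_rfl
  rw [lt_div_iff₀ hκ]
  nlinarith

end CardA

/-! ## § CardB — conditional-covariance floor -/

section CardB

/-- **Law of total covariance** over Mathlib's conditional expectation (signature; the identity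
`Cov(X,Y) = E[(X − E[X|m])(Y − E[Y|m])] + Cov(E[X|m], E[Y|m])` for square-integrable `X, Y`). -/
def LawOfTotalCovariance : Prop :=
  ∀ (Ω : Type) (m m₀ : MeasurableSpace Ω) (μ : Measure Ω) [IsProbabilityMeasure μ],
    m ≤ m₀ → ∀ X Y : Ω → ℝ, MemLp X 2 μ → MemLp Y 2 μ →
      cov[X, Y; μ] =
        (∫ ω, (X ω - (μ[X|m]) ω) * (Y ω - (μ[Y|m]) ω) ∂μ) + cov[μ[X|m], μ[Y|m]; μ]

/-- **Invariant-conditioning floor**: if the two conditional means coincide a.e. (e.g. `m` generated by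
translation-invariant gauge-invariant functions and `Y` a lattice translate of `X` under a
translation-invariant law), the covariance DOMINATES the mean conditional covariance — the second term
of the law of total covariance is a variance. Exact, all `β, L, G`. -/
def InvariantConditioningFloor : Prop :=
  ∀ (Ω : Type) (m m₀ : MeasurableSpace Ω) (μ : Measure Ω) [IsProbabilityMeasure μ],
    m ≤ m₀ → ∀ X Y : Ω → ℝ, MemLp X 2 μ → MemLp Y 2 μ → μ[X|m] =ᵐ[μ] μ[Y|m] →
      (∫ ω, (X ω - (μ[X|m]) ω) * (Y ω - (μ[Y|m]) ω) ∂μ) ≤ cov[X, Y; μ]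

variable {G : Type} [Group G] [TopologicalSpace G] [IsTopologicalGroup G] [CompactSpace G]
  [MeasurableSpace G] [BorelSpace G] {N : ℕ}

/-- Site `(v₀, v₁, t, v₃)` of the transverse block at `e₂`-time `t`. -/
def tblockSite (L n : ℕ) (t : ℕ) (v : Fin n × Fin n × Fin n) : Site 4 L :=
  ![((v.1 : ℕ) : ZMod L), ((v.2.1 : ℕ) : ZMod L), ((t : ℕ) : ZMod L), ((v.2.2 : ℕ) : ZMod L)]

/-- Transverse block plaquette `B_n(t) = n⁻³ ∑_{v ∈ [0,n)³} P^{01}_{(v₀,v₁,t,v₃)}` (lies in the slice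
`x₂ = t`, as the crux's reference plaquettes do). -/
def blockPlaq (ρ : G →* Matrix (Fin N) (Fin N) ℂ) (L n : ℕ) (t : ℕ) (U : GaugeConfig 4 L G) : ℝ :=
  ((n : ℝ) ^ 3)⁻¹ * ∑ v : Fin n × Fin n × Fin n, plaq ρ (tblockSite L n t v) 0 1 U

/-- **Smearing domination** (Bochner for the RP-positive-definite slice kernel; provable now from the
landed transfer-matrix positivity): smearing both plaquettes over a transverse block at fixed
`e₂`-separation can only LOWER the covariance below the on-axis point value. -/
def SmearingDomination (ρ : G →* Matrix (Fin N) (Fin N) ℂ) : Prop :=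
  ∀ (L : ℕ) [NeZero L] (β : ℝ) (n t : ℕ), 0 ≤ β → 1 ≤ n → n ≤ L →
    cov ρ β (blockPlaq ρ L n 0) (blockPlaq ρ L n t) ≤
      cov ρ β (plaq ρ (0 : Site 4 L) 0 1) (plaq ρ (Pi.single (2 : Fin 4) ((t : ℕ) : ZMod L)) 0 1)

/-- **Block matching, lower half** — the engine statement of card B: the block–block covariance at
block distance `n` (a dimensionless response between two disjoint codimension-one blocks) is bounded
BELOW by the squared coupling of the box `8n`, in every window box.  Mechanism: law of total covariance
w.r.t. the scale-`n` block field — conditional decoupling of fluctuations (massive on the block scale)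
+ covariance of conditional means = tree-level Wick square under the near-Gaussian background law. -/
def BlockMatchingLower (ρ : G →* Matrix (Fin N) (Fin N) ℂ) (u : ℕ → ℝ → ℝ) (u₀ β₀ c : ℝ) : Prop :=
  ∀ (L : ℕ) [NeZero L] (β : ℝ) (n : ℕ), β₀ ≤ β → 1 ≤ n → 8 * n ≤ L → InWindow u u₀ L β →
    c * u (8 * n) β ^ 2 ≤ (n : ℝ) ^ 8 * cov ρ β (blockPlaq ρ L n 0) (blockPlaq ρ L n n)

/-- **Composition (proved): block lower bound + smearing domination ⇒ the LOWER half of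
`AxisMatching`** — the load-bearing half of the crux (`Negative.UpperOnly`). -/
theorem axisMatchingLower_of_block {ρ : G →* Matrix (Fin N) (Fin N) ℂ} {u : ℕ → ℝ → ℝ}
    {u₀ β₀ c : ℝ} (hβ₀ : 0 ≤ β₀) (hdom : SmearingDomination ρ) (hblk : BlockMatchingLower ρ u u₀ β₀ c) :
    ∀ (L : ℕ) [NeZero L] (β : ℝ) (n : ℕ), β₀ ≤ β → 1 ≤ n → 8 * n ≤ L → InWindow u u₀ L β →
      c * u (8 * n) β ^ 2 ≤ axisAmp ρ L β n := by
  intro L _ β n hβ hn hnL hw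
  have h1 := hblk L β n hβ hn hnL hw
  have h2 := hdom L β n n (hβ₀.trans hβ) hn (by omega)
  have h8 : (0 : ℝ) ≤ (n : ℝ) ^ 8 := by positivity
  calc c * u (8 * n) β ^ 2 ≤ (n : ℝ) ^ 8 * cov ρ β (blockPlaq ρ L n 0) (blockPlaq ρ L n n) := h1
    _ ≤ axisAmp ρ L β n := by
        unfold axisAmp
        exact mul_le_mul_of_nonneg_left h2 h8

end CardB

/-! ## § Link — the crux is `∀ G simple compact, ∀ r, PackageC r.ρ` -/

/-- Definitional unbundling of the tier-deciding crux (as `femtoCurvatureTwoPoint_iff` in the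
predecessor's Disproof § Defs). -/
theorem femtoCurvatureTwoPointC_iff :
    Summit.QuantumFields.YangMills.Theses.LangevinControlUV.FemtoCurvatureTwoPointC ↔
      ∀ (G : Type) [Group G] [TopologicalSpace G] [IsTopologicalGroup G] [CompactSpace G],
        IsCompactSimpleLieGroup G →
          letI : MeasurableSpace G := borel G
          haveI : BorelSpace G := ⟨rfl⟩
          ∀ r : LatticeRep G, PackageC r.ρ :=
  Iff.rfl

/-- Hence a proof of `IntrinsicEncoding r.ρ` for all `(G, r)` plus CONSTRUCTIONS of an admissible
coupling with `AFStep`, `AxisMatching`, `PairMatching` closes the crux BY NAME. -/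
theorem femtoCurvatureTwoPointC_of_intrinsic
    (h : ∀ (G : Type) [Group G] [TopologicalSpace G] [IsTopologicalGroup G] [CompactSpace G],
        IsCompactSimpleLieGroup G →
          letI : MeasurableSpace G := borel G
          haveI : BorelSpace G := ⟨rfl⟩
          ∀ r : LatticeRep G, IntrinsicEncoding r.ρ ∧
            ∃ (u : ℕ → ℝ → ℝ) (u₀ β₀ κ₁ κ₂ c C : ℝ), 0 < u₀ ∧ 0 < c ∧ AdmissibleCoupling u β₀ ∧
              AFStep u u₀ β₀ κ₁ κ₂ ∧ AxisMatching r.ρ u u₀ β₀ c C ∧ PairMatching r.ρ u u₀ β₀ C) :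
    Summit.QuantumFields.YangMills.Theses.LangevinControlUV.FemtoCurvatureTwoPointC := by
  rw [femtoCurvatureTwoPointC_iff]
  intro G _ _ _ _ hG r
  obtain ⟨henc, u, u₀, β₀, κ₁, κ₂, c, C, hu₀, hc, hadm, hstep, hax, hpair⟩ := h G hG r
  exact henc u u₀ β₀ κ₁ κ₂ c C hu₀ hc hadm hstep hax hpair

end Summit.QuantumFields.YangMills.Cruxes.FemtoCurvatureTwoPointC.Ideator1

end
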